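import Mathlib
import Summits.KontsevichZagierPeriods.Zeta5Search.Families.BasicGrowthProjective
import HarnessLib

/-!
# ζ(5) search — Families: DUALITY of the growth constant — `1/M_{σ⁻¹} = inf_{X_σ} F_σ` and `M_σ = sup_{X_δ} F_σ`

HONEST FRAMING: systematic search; no irrationality claim unless certified.  STRUCTURAL facts about the size of
Brown's basic cellular integrals [Brown2016, §1.5 (1.3)–(1.4)] (seat P2, Families layer); nothing about the
arithmetic of any zeta value.

With the projective Brown function `FSigma σ z` of `Families/BasicGrowthProjective.lean` (`PGL₂`-invariant, dual under
`σ ↔ σ⁻¹`, equal to the simplicial `fSigma σ` on normal forms) this file identifies the growth constants of a seating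
`σ` AND of its dual `σ⁻¹` as the two extreme values of the SAME rational function `F_σ` on two cells of `M_{0,n}(ℝ)`:
* `nfM`, `nfT`, `nfG_apply`, `nfT_mem` — the cross-ratio NORMAL FORM of an increasing configuration `w`
  (`w_0 ↦ 0`, `w_{ℓ+1} ↦ 1`, `w_{ℓ+2} ↦ ∞`) lies in the open simplex, and an explicit Möbius map, finite on `w`, carries
  `w` to the finite representative `zOf (nfT w)`;
* `image_FSigma_stdCell` / **`fSup_eq_sSup_stdCell`** — on the standard cell `X_δ = {z increasing}` the values of `F_σ`
  are exactly the values of `f_σ` on the simplex, so **`M_σ = sup_{X_δ} F_σ`** (all real configurations in the standard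
  dihedral order, not only normal forms); `FSigma_le_fSup`;
* `image_FSigma_dualCell` / **`inv_fSup_eq_sInf_dualCell`** / `fSup_mul_sInf_dualCell` — for `σ ∘ τ = id = τ ∘ σ`, on
  the DUAL cell `X_σ = {z : z ∘ σ increasing}` (configurations seated in the order `σ`) the values of `F_σ` are exactly
  the reciprocals `1/f_τ(t)`, hence **`1/M_{σ⁻¹} = inf_{X_σ} F_σ`**, i.e. `M_{σ⁻¹} · inf_{X_σ} F_σ = 1`;
  `inv_fSup_le_FSigma` (`F_σ ≥ 1/M_{σ⁻¹}` on `X_σ`); `inv_fSup_symm_eq_sInf` (the `Equiv.Perm` form).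
READING (not asserted beyond the statements above): `M_σ = max_{X_δ} F_σ` and `1/M_{σ⁻¹} = min_{X_σ} F_σ` are both
CRITICAL VALUES of the one rational function `F_σ` on `M_{0,n}` (interior extrema on two cells; the maximum is attained
by `Families/BasicGrowthMaximum`), which is why, whenever the critical-value polynomial of `F_σ` is irreducible, the
minimal polynomials of `M_σ` and `M_{σ⁻¹}` are mutually RECIPROCAL — as observed for all `18 + 105` classes with
`N ≤ 9` in the exact atlas (`Families/Exact*`; for `₈π₈^∨`: `λ₁ = M_{₈π₈^∨}`, `λ₃ = 1/M_{₈π₈}` are two roots of BZ's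
`4λ³ − 2368λ² − 188λ + 1`, `Families/ExactDualityBZ`).  Standard axioms only.
-/

noncomputable section

open Finset Set

namespace Summit.KontsevichZagierPeriods.Zeta5Search.Families.Cellular

variable {ℓ : ℕ} (σ : Fin (ℓ + 3) → Fin (ℓ + 3))

/-! ### Normal forms: every configuration seated in the order `σ` is Möbius-equivalent to some `zOf t ∘ σ⁻¹` -/

section NormalForm

variable (w : Fin (ℓ + 3) → ℝ)

/-- The label `ℓ + 1` (the marked point `1` of a normal form) as an element of `Fin (ℓ + 3)`. -/
abbrev idxOne (ℓ : ℕ) : Fin (ℓ + 3) := ⟨ℓ + 1, by omega⟩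

/-- The cross-ratio normalisation of an increasing configuration `w`: the Möbius map with
`w₀ ↦ 0`, `w_{ℓ+1} ↦ 1`, `w_{ℓ+2} ↦ ∞`, namely `nfM w x = (x − w₀)(w_{ℓ+1} − w_{ℓ+2}) / ((x − w_{ℓ+2})(w_{ℓ+1} − w₀))`. -/
def nfM (x : ℝ) : ℝ :=
  (x - w 0) * (w (idxOne ℓ) - w (Fin.last (ℓ + 2))) / ((x - w (Fin.last (ℓ + 2))) * (w (idxOne ℓ) - w 0))

/-- The simplicial coordinates of the normal form of `w`: `t_j = nfM w (w_{j+1})`, `j = 0,…,ℓ−1`. -/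
def nfT : Fin ℓ → ℝ := fun j => nfM w (w ⟨j.val + 1, by omega⟩)

/-- The coefficients `A, B, C, D` of the Möbius map `G = (x ↦ x/(1+x)) ∘ nfM w`, written as `(A x + B)/(C x + D)`
(so that it is finite at `w_{ℓ+2}` too, with value `1`). -/
def nfA : ℝ := w (idxOne ℓ) - w (Fin.last (ℓ + 2))

/-- See `nfA`. -/
def nfB : ℝ := -(w 0 * (w (idxOne ℓ) - w (Fin.last (ℓ + 2))))

/-- See `nfA`. -/
def nfC : ℝ := (w (idxOne ℓ) - w 0) + (w (idxOne ℓ) - w (Fin.last (ℓ + 2)))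

/-- See `nfA`. -/
def nfD : ℝ := -(w (Fin.last (ℓ + 2)) * (w (idxOne ℓ) - w 0)) - w 0 * (w (idxOne ℓ) - w (Fin.last (ℓ + 2)))

variable {w}

/-- For increasing `w`: `w₀ < w_{ℓ+1}`. -/
theorem nf_zero_lt_one (hw : StrictMono w) : w 0 < w (idxOne ℓ) :=
  hw (Fin.lt_def.2 (by simp))

/-- For increasing `w`: `w_{ℓ+1} < w_{ℓ+2}`. -/
theorem nf_one_lt_last (hw : StrictMono w) : w (idxOne ℓ) < w (Fin.last (ℓ + 2)) :=
  hw (Fin.lt_def.2 (by simp [Fin.val_last]))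

/-- For increasing `w` and every label `k`: `w₀ ≤ w_k`. -/
theorem nf_zero_le (hw : StrictMono w) (k : Fin (ℓ + 3)) : w 0 ≤ w k :=
  hw.monotone (Fin.zero_le _)

/-- For increasing `w` and a finite label `k ≤ ℓ+1`: `w_k < w_{ℓ+2}`. -/
theorem nf_lt_last (hw : StrictMono w) {k : Fin (ℓ + 3)} (hk : k.val ≠ ℓ + 2) : w k < w (Fin.last (ℓ + 2)) :=
  hw (Fin.lt_def.2 (by rw [Fin.val_last]; have := k.isLt; omega))

/-- For increasing `w` and a finite label `k ≤ ℓ+1`: `w_k ≤ w_{ℓ+1}`. -/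
theorem nf_le_one (hw : StrictMono w) {k : Fin (ℓ + 3)} (hk : k.val ≠ ℓ + 2) : w k ≤ w (idxOne ℓ) :=
  hw.monotone (Fin.le_def.2 (by have := k.isLt; simp; omega))

/-- The determinant of `G`: `A D − B C = (w_{ℓ+1} − w_{ℓ+2})(w_{ℓ+1} − w₀)(w₀ − w_{ℓ+2})`. -/
theorem nf_det : nfA w * nfD w - nfB w * nfC w =
    (w (idxOne ℓ) - w (Fin.last (ℓ + 2))) * (w (idxOne ℓ) - w 0) * (w 0 - w (Fin.last (ℓ + 2))) := by
  unfold nfA nfB nfC nfD; ring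

/-- The determinant of `G` is non-zero for increasing `w`. -/
theorem nf_det_ne_zero (hw : StrictMono w) : nfA w * nfD w - nfB w * nfC w ≠ 0 := by
  rw [nf_det]
  have h1 := nf_zero_lt_one hw
  have h2 := nf_one_lt_last hw
  exact mul_ne_zero (mul_ne_zero (by linarith) (by linarith)) (by linarith)

/-- `C x + D = (x − w_{ℓ+2})(w_{ℓ+1} − w₀) + (x − w₀)(w_{ℓ+1} − w_{ℓ+2})`. -/
theorem nfC_mul_add (x : ℝ) : nfC w * x + nfD w =
    (x - w (Fin.last (ℓ + 2))) * (w (idxOne ℓ) - w 0) + (x - w 0) * (w (idxOne ℓ) - w (Fin.last (ℓ + 2))) := by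
  unfold nfC nfD; ring

/-- `A x + B = (x − w₀)(w_{ℓ+1} − w_{ℓ+2})`. -/
theorem nfA_mul_add (x : ℝ) : nfA w * x + nfB w = (x - w 0) * (w (idxOne ℓ) - w (Fin.last (ℓ + 2))) := by
  unfold nfA nfB; ring

/-- The denominator of `G` is NEGATIVE at every point of an increasing configuration (so `G` is finite there). -/
theorem nfC_mul_add_neg (hw : StrictMono w) (k : Fin (ℓ + 3)) : nfC w * w k + nfD w < 0 := by
  rw [nfC_mul_add]
  have h1 := nf_zero_lt_one hw
  have h2 := nf_one_lt_last hw
  have h0 := nf_zero_le hw k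
  by_cases hk : k.val = ℓ + 2
  · have : k = Fin.last (ℓ + 2) := Fin.ext (by rw [Fin.val_last]; exact hk)
    rw [this, sub_self, zero_mul, zero_add]
    exact mul_neg_of_pos_of_neg (by linarith) (by linarith)
  · have h3 := nf_lt_last hw hk
    have ha : (w k - w (Fin.last (ℓ + 2))) * (w (idxOne ℓ) - w 0) < 0 :=
      mul_neg_of_neg_of_pos (by linarith) (by linarith)
    have hb : (w k - w 0) * (w (idxOne ℓ) - w (Fin.last (ℓ + 2))) ≤ 0 :=
      mul_nonpos_of_nonneg_of_nonpos (by linarith) (by linarith)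
    linarith

/-- `nfM w (w₀) = 0`. -/
theorem nfM_zero : nfM w (w 0) = 0 := by simp [nfM]

/-- `nfM w (w_{ℓ+1}) = 1` for increasing `w`. -/
theorem nfM_one (hw : StrictMono w) : nfM w (w (idxOne ℓ)) = 1 := by
  have h1 := nf_zero_lt_one hw
  have h2 := nf_one_lt_last hw
  unfold nfM
  rw [mul_comm, div_self (mul_ne_zero (by linarith) (by linarith))]

/-- The marked points of the normal form: `pt (nfT w) k = nfM w (w_k)` for every finite label `k ≤ ℓ + 1`. -/
theorem pt_nfT (hw : StrictMono w) {k : ℕ} (hk : k ≤ ℓ + 1) : pt (nfT w) k = nfM w (w ⟨k, by omega⟩) := by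
  rcases Nat.eq_zero_or_pos k with rfl | hk0
  · rw [pt_zero]
    exact (nfM_zero (w := w)).symm
  by_cases hkℓ : k ≤ ℓ
  · rw [pt_of_pos _ hk0 hkℓ]
    unfold nfT
    congr 2
    exact Fin.ext (by simp; omega)
  · have hk1 : k = ℓ + 1 := by omega
    subst hk1
    rw [pt_of_gt _ le_rfl]
    exact (nfM_one hw).symm

/-- `nfM w` is increasing along an increasing configuration: for finite labels `u < v` (both `≤ ℓ+1`),
`nfM w (w_u) < nfM w (w_v)`. -/
theorem nfM_lt (hw : StrictMono w) {u v : Fin (ℓ + 3)} (huv : u < v) (hv : v.val ≠ ℓ + 2) :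
    nfM w (w u) < nfM w (w v) := by
  have h1 := nf_zero_lt_one hw
  have h2 := nf_one_lt_last hw
  have huInf := nf_lt_last hw (k := u) (by have := Fin.lt_def.1 huv; omega)
  have hvInf := nf_lt_last hw hv
  have hwuv : w u < w v := hw huv
  have hne1 : w v - w (Fin.last (ℓ + 2)) ≠ 0 := (sub_neg.2 hvInf).ne
  have hne2 : w u - w (Fin.last (ℓ + 2)) ≠ 0 := (sub_neg.2 huInf).ne
  have hne3 : w (idxOne ℓ) - w 0 ≠ 0 := (sub_pos.2 h1).ne'
  have key : nfM w (w v) - nfM w (w u) =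
      (w (idxOne ℓ) - w (Fin.last (ℓ + 2))) / (w (idxOne ℓ) - w 0) * ((w 0 - w (Fin.last (ℓ + 2))) * (w v - w u)) /
        ((w v - w (Fin.last (ℓ + 2))) * (w u - w (Fin.last (ℓ + 2)))) := by
    unfold nfM
    field_simp
    ring
  have hpos : 0 < nfM w (w v) - nfM w (w u) := by
    rw [key]
    apply div_pos
    · apply mul_pos_of_neg_of_neg
      · exact div_neg_of_neg_of_pos (by linarith) (by linarith)
      · exact mul_neg_of_neg_of_pos (by linarith) (by linarith)
    · exact mul_pos_of_neg_of_neg (by linarith) (by linarith)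
  linarith

/-- **The normal form lies in the open simplex** (for an increasing configuration). -/
theorem nfT_mem (hw : StrictMono w) : nfT w ∈ openSimplex ℓ := by
  intro k
  have hk := k.isLt
  rw [show ((k : ℕ) : ℕ) + 1 = (k : ℕ) + 1 from rfl]
  rw [pt_nfT hw (by omega), pt_nfT hw (by omega)]
  exact nfM_lt hw (Fin.lt_def.2 (by simp)) (by simp; omega)

/-- **The Möbius map `G` sends `w` to the finite representative of its normal form**:
`(A w_k + B)/(C w_k + D) = zOf (nfT w) k` for every label `k` (including `∞`, where both sides are `1`). -/
theorem nfG_apply (hw : StrictMono w) (k : Fin (ℓ + 3)) :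
    (nfA w * w k + nfB w) / (nfC w * w k + nfD w) = zOf (nfT w) k := by
  have hden : nfC w * w k + nfD w ≠ 0 := (nfC_mul_add_neg hw k).ne
  have h1 := nf_zero_lt_one hw
  have h2 := nf_one_lt_last hw
  rw [nfA_mul_add, nfC_mul_add] at *
  unfold zOf
  by_cases hk : k.val = ℓ + 2
  · have : k = Fin.last (ℓ + 2) := Fin.ext (by rw [Fin.val_last]; exact hk)
    rw [if_pos hk, this, sub_self, zero_mul, zero_add, div_self]
    exact mul_ne_zero (by linarith) (by linarith)
  · rw [if_neg hk, pt_nfT hw (k := k.val) (by have := k.isLt; omega)]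
    have hkInf := nf_lt_last hw hk
    have hne1 : w k - w (Fin.last (ℓ + 2)) ≠ 0 := (sub_neg.2 hkInf).ne
    have hne3 : w (idxOne ℓ) - w 0 ≠ 0 := (sub_pos.2 h1).ne'
    unfold nfM
    simp only [Fin.eta]
    rw [div_eq_iff hden]
    field_simp

end NormalForm

/-! ### The two cells and the main theorems -/

/-- `zOf t` is an increasing configuration for `t` in the open simplex. -/
theorem zOf_strictMono {t : Fin ℓ → ℝ} (ht : t ∈ openSimplex ℓ) : StrictMono (zOf t) := by
  intro u v huv
  have hpos : 0 < zOf t v - zOf t u := by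
    rw [zOf_sub_zOf_of_lt ht (Fin.lt_def.1 huv)]
    exact div_pos (ef_pos ht huv.ne) (mul_pos (wOf_pos ht u) (wOf_pos ht v))
  linarith

/-- A two-sided inverse pair of seatings consists of bijections. -/
theorem bijective_of_inverse {σ τ : Fin (ℓ + 3) → Fin (ℓ + 3)} (hστ : ∀ i, σ (τ i) = i) (hτσ : ∀ i, τ (σ i) = i) :
    Function.Bijective τ :=
  ⟨fun a b h => by simpa only [hστ] using congrArg σ h, fun y => ⟨σ y, hτσ y⟩⟩

/-- **Every increasing configuration is Möbius-equivalent to its normal form**: for bijective `σ` and increasing `z`,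
`F_σ(z) = f_σ(nfT z)` (the standard cell `X_δ`). -/
theorem FSigma_eq_fSigma_nfT (hσ : Function.Bijective σ) {z : Fin (ℓ + 3) → ℝ} (hz : StrictMono z) :
    FSigma σ z = fSigma σ (nfT z) := by
  calc FSigma σ z = FSigma σ (fun k => (nfA z * z k + nfB z) / (nfC z * z k + nfD z)) :=
        (FSigma_moebius σ hσ z (nf_det_ne_zero hz) fun k => (nfC_mul_add_neg hz k).ne).symm
    _ = FSigma σ (zOf (nfT z)) := by
        congr 1
        funext k
        exact nfG_apply hz k
    _ = fSigma σ (nfT z) := (fSigma_eq_FSigma_zOf σ hσ (nfT_mem hz)).symm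

/-- **The dual cell**: if `σ ∘ τ = id = τ ∘ σ` and `w` is increasing, then the configuration `w ∘ τ` (seated in the
order `σ`: `(w ∘ τ) ∘ σ = w`) has `F_σ(w ∘ τ) = 1 / f_τ(nfT w)`. -/
theorem FSigma_comp_eq_inv {σ τ : Fin (ℓ + 3) → Fin (ℓ + 3)} (hστ : ∀ i, σ (τ i) = i) (hτσ : ∀ i, τ (σ i) = i)
    {w : Fin (ℓ + 3) → ℝ} (hw : StrictMono w) : FSigma σ (w ∘ τ) = (fSigma τ (nfT w))⁻¹ := by
  have hτ := bijective_of_inverse hστ hτσ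
  have hσ : Function.Bijective σ := bijective_of_inverse hτσ hστ
  calc FSigma σ (w ∘ τ)
      = FSigma σ (fun k => (nfA w * (w ∘ τ) k + nfB w) / (nfC w * (w ∘ τ) k + nfD w)) :=
        (FSigma_moebius σ hσ (w ∘ τ) (nf_det_ne_zero hw) fun k => (nfC_mul_add_neg hw (τ k)).ne).symm
    _ = FSigma σ (zOf (nfT w) ∘ τ) := by
        congr 1
        funext k
        exact nfG_apply hw (τ k)
    _ = (FSigma τ (zOf (nfT w)))⁻¹ := FSigma_dual hτσ _
    _ = (fSigma τ (nfT w))⁻¹ := by rw [← fSigma_eq_FSigma_zOf τ hτ (nfT_mem hw)]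

/-- The same for a configuration `z` seated in the order `σ` (`z ∘ σ` increasing): `F_σ(z) = 1 / f_τ(nfT (z ∘ σ))`. -/
theorem FSigma_eq_inv_fSigma {σ τ : Fin (ℓ + 3) → Fin (ℓ + 3)} (hστ : ∀ i, σ (τ i) = i) (hτσ : ∀ i, τ (σ i) = i)
    {z : Fin (ℓ + 3) → ℝ} (hz : StrictMono (z ∘ σ)) : FSigma σ z = (fSigma τ (nfT (z ∘ σ)))⁻¹ := by
  have e : (z ∘ σ) ∘ τ = z := funext fun k => congrArg z (hστ k)
  calc FSigma σ z = FSigma σ ((z ∘ σ) ∘ τ) := by rw [e]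
    _ = _ := FSigma_comp_eq_inv hστ hτσ hz

/-- **The standard cell**: the values of `F_σ` on the increasing configurations (the cell `X_δ` of all real
configurations in the standard dihedral order) are exactly the values of the simplicial `f_σ` on the open simplex. -/
theorem image_FSigma_stdCell (hσ : Function.Bijective σ) :
    FSigma σ '' {z : Fin (ℓ + 3) → ℝ | StrictMono z} = fSigma σ '' openSimplex ℓ := by
  ext y
  constructor
  · rintro ⟨z, hz, rfl⟩
    exact ⟨nfT z, nfT_mem hz, (FSigma_eq_fSigma_nfT σ hσ hz).symm⟩
  · rintro ⟨t, ht, rfl⟩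
    exact ⟨zOf t, zOf_strictMono ht, (fSigma_eq_FSigma_zOf σ hσ ht).symm⟩

/-- **The dual cell**: for `σ ∘ τ = id = τ ∘ σ`, the values of `F_σ` on the configurations seated in the order `σ`
(the cell `X_σ`: `z ∘ σ` increasing) are exactly the reciprocals of the values of `f_τ = f_{σ⁻¹}` on the open simplex. -/
theorem image_FSigma_dualCell {σ τ : Fin (ℓ + 3) → Fin (ℓ + 3)} (hστ : ∀ i, σ (τ i) = i) (hτσ : ∀ i, τ (σ i) = i) :
    FSigma σ '' {z : Fin (ℓ + 3) → ℝ | StrictMono (z ∘ σ)} = (fun t => (fSigma τ t)⁻¹) '' openSimplex ℓ := by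
  have hτ := bijective_of_inverse hστ hτσ
  ext y
  constructor
  · rintro ⟨z, hz, rfl⟩
    exact ⟨nfT (z ∘ σ), nfT_mem hz, (FSigma_eq_inv_fSigma hστ hτσ hz).symm⟩
  · rintro ⟨t, ht, rfl⟩
    refine ⟨zOf t ∘ τ, ?_, ?_⟩
    · have e : (zOf t ∘ τ) ∘ σ = zOf t := funext fun k => congrArg (zOf t) (hτσ k)
      show StrictMono ((zOf t ∘ τ) ∘ σ)
      rw [e]
      exact zOf_strictMono ht
    · show FSigma σ (zOf t ∘ τ) = (fSigma τ t)⁻¹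
      rw [FSigma_dual hτσ, fSigma_eq_FSigma_zOf τ hτ ht]

/-- **`M_σ = sup_{X_δ} F_σ`**: the growth constant is the supremum of the projective Brown function over ALL real
configurations in the standard order (not only normal forms). -/
theorem fSup_eq_sSup_stdCell (hσ : Function.Bijective σ) :
    fSup σ = sSup (FSigma σ '' {z : Fin (ℓ + 3) → ℝ | StrictMono z}) := by
  rw [image_FSigma_stdCell σ hσ]
  rfl

/-- Reciprocals turn the supremum of a bounded set of positive reals into the infimum of the reciprocals. -/
theorem sInf_image_inv_eq {S : Set ℝ} (hne : S.Nonempty) (hpos : ∀ x ∈ S, 0 < x) (hbdd : BddAbove S) :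
    sInf ((fun x => x⁻¹) '' S) = (sSup S)⁻¹ := by
  obtain ⟨x₀, hx₀⟩ := hne
  have hM : 0 < sSup S := (hpos x₀ hx₀).trans_le (le_csSup hbdd hx₀)
  have hTne : ((fun x => x⁻¹) '' S).Nonempty := ⟨_, x₀, hx₀, rfl⟩
  have hTbdd : BddBelow ((fun x => x⁻¹) '' S) := ⟨0, by rintro _ ⟨x, hx, rfl⟩; exact (inv_pos.2 (hpos x hx)).le⟩
  have h1 : (sSup S)⁻¹ ≤ sInf ((fun x => x⁻¹) '' S) :=
    le_csInf hTne (by rintro _ ⟨x, hx, rfl⟩; exact inv_anti₀ (hpos x hx) (le_csSup hbdd hx))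
  refine le_antisymm ?_ h1
  have hI : 0 < sInf ((fun x => x⁻¹) '' S) := (inv_pos.2 hM).trans_le h1
  have h2 : sSup S ≤ (sInf ((fun x => x⁻¹) '' S))⁻¹ :=
    csSup_le ⟨x₀, hx₀⟩ fun x hx => by
      rw [le_inv_comm₀ (hpos x hx) hI]
      exact csInf_le hTbdd ⟨x, hx, rfl⟩
  rw [← inv_inv (sInf _)]
  exact inv_anti₀ hM h2

/-- **DUALITY OF THE GROWTH CONSTANT: `1 / M_{σ⁻¹} = inf_{X_σ} F_σ`.**  For a seating `σ` with inverse `τ = σ⁻¹`, the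
reciprocal of the growth constant of the DUAL configuration is the infimum of Brown's function `F_σ` over all real
configurations seated in the order `σ` (the cell `X_σ`).  Together with `fSup_eq_sSup_stdCell` (`M_σ = sup_{X_δ} F_σ`):
the two growth constants of a dual pair are the two extreme values of ONE rational function on two cells. -/
theorem inv_fSup_eq_sInf_dualCell {σ τ : Fin (ℓ + 3) → Fin (ℓ + 3)} (hστ : ∀ i, σ (τ i) = i)
    (hτσ : ∀ i, τ (σ i) = i) :
    (fSup τ)⁻¹ = sInf (FSigma σ '' {z : Fin (ℓ + 3) → ℝ | StrictMono (z ∘ σ)}) := by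
  have hτ := bijective_of_inverse hστ hτσ
  rw [image_FSigma_dualCell hστ hτσ, show (fun t => (fSigma τ t)⁻¹) '' openSimplex ℓ =
    (fun x => x⁻¹) '' (fSigma τ '' openSimplex ℓ) by rw [Set.image_image]]
  exact (sInf_image_inv_eq ((openSimplex_nonempty ℓ).image _)
    (by rintro _ ⟨t, ht, rfl⟩; exact fSigma_pos τ hτ.1 ht) (bddAbove_fSigma_image τ hτ)).symm

/-- Product form: **`M_{σ⁻¹} · inf_{X_σ} F_σ = 1`**. -/
theorem fSup_mul_sInf_dualCell {σ τ : Fin (ℓ + 3) → Fin (ℓ + 3)} (hστ : ∀ i, σ (τ i) = i)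
    (hτσ : ∀ i, τ (σ i) = i) :
    fSup τ * sInf (FSigma σ '' {z : Fin (ℓ + 3) → ℝ | StrictMono (z ∘ σ)}) = 1 := by
  rw [← inv_fSup_eq_sInf_dualCell hστ hτσ,
    mul_inv_cancel₀ (fSup_pos τ (bijective_of_inverse hστ hτσ)).ne']

/-- On the dual cell Brown's function is bounded BELOW by `1/M_{σ⁻¹}` (`≥ 2^{n−2}` by `Families/BasicGrowthHalfPow`
when `σ⁻¹` is convergent): `z ∘ σ` increasing ⇒ `1/M_{σ⁻¹} ≤ F_σ(z)`. -/
theorem inv_fSup_le_FSigma {σ τ : Fin (ℓ + 3) → Fin (ℓ + 3)} (hστ : ∀ i, σ (τ i) = i) (hτσ : ∀ i, τ (σ i) = i)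
    {z : Fin (ℓ + 3) → ℝ} (hz : StrictMono (z ∘ σ)) : (fSup τ)⁻¹ ≤ FSigma σ z := by
  have hτ := bijective_of_inverse hστ hτσ
  rw [FSigma_eq_inv_fSigma hστ hτσ hz]
  exact inv_anti₀ (fSigma_pos τ hτ.1 (nfT_mem hz)) (fSigma_le_fSup τ hτ (nfT_mem hz))

/-- On the standard cell `F_σ ≤ M_σ`: `z` increasing ⇒ `F_σ(z) ≤ M_σ`. -/
theorem FSigma_le_fSup (hσ : Function.Bijective σ) {z : Fin (ℓ + 3) → ℝ} (hz : StrictMono z) :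
    FSigma σ z ≤ fSup σ := by
  rw [FSigma_eq_fSigma_nfT σ hσ hz]
  exact fSigma_le_fSup σ hσ (nfT_mem hz)

/-- `Equiv.Perm` form of the duality: **`(M_{σ⁻¹})⁻¹ = inf_{X_σ} F_σ`** for a permutation `σ` of the labels. -/
theorem inv_fSup_symm_eq_sInf (σ : Equiv.Perm (Fin (ℓ + 3))) :
    (fSup ⇑σ.symm)⁻¹ = sInf (FSigma ⇑σ '' {z : Fin (ℓ + 3) → ℝ | StrictMono (z ∘ ⇑σ)}) :=
  inv_fSup_eq_sInf_dualCell σ.apply_symm_apply σ.symm_apply_apply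

end Summit.KontsevichZagierPeriods.Zeta5Search.Families.Cellular
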